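import Mathlib
import Summits.Ventures.PercRepro2.Defs
import Summits.Ventures.PercRepro2.Graph
import Summits.Ventures.PercRepro2.Harris
import Summits.Ventures.PercRepro2.VdBKahn
import Summits.Ventures.PercRepro2.RowC1PendZ

/-!
# The symmetric strengthening `(C3)` of the pendant-root candidate `(Z″)` (blind cell PercRepro2, p2 g36)

On `G − a₁` with root `a₂`, attachment vertex `v` and marks `o`, `b`, write `F = {v ↔ a₂}`,
`O = {o ↔ a₂}`, `B = {b ↔ a₂}`, `R_o = Fᶜ ∩ {v ↔ o}`, `R_b = Fᶜ ∩ {v ↔ b}`, `p = P(Fᶜ)`, `q = P(F)`.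
The pendant-root candidate is `zpp = p² · Cov(O,B) + Cov(O,F) · Cov(B,F) − P(R_o) · Cov(B,F)`
(RowC1PendZ.lean).  This file records the **symmetric** quantity

  `zsym = p · Cov(O,B) + q · P(R_o) · P(R_b) − Cov(O,F) · P(R_b) − Cov(B,F) · P(R_o)`

(symmetric under `o ↔ b`; in the law-of-total-covariance form
`zsym = p · [q · Cov(O,B | F) + p · Cov(O,B | Fᶜ) + p q · Δ_E · Δ_{B⁺}]`, with
`E = {o ↔ {a₂, v}}`, `B⁺ = {b ↔ {a₂, v}}` and `Δ_X = P(X | F) − P(X | Fᶜ)`), and the exact identity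

  `zpp = p · zsym + T₃ · (T₄ + p · P(R_b))`

with the kernel's Harris shifts `T₃ = zppShiftO ≥ 0` and `T₄ = zppShiftB ≥ 0`
(`zppShiftO_nonneg`, `zppShiftB_nonneg`).  Hence **`zsym ≥ 0` implies `zpp ≥ 0`**
(`zpp_nonneg_of_zsym_nonneg`): the symmetric statement `(C3)` is a strengthening of `(Z″)`.
The identity uses only `P(Fᶜ) = 1 − P(F)` and the splits `P(X) = P(X ∩ F) + P(X ∩ Fᶜ)`.
Evidence for `zsym ≥ 0` itself (not claimed here): proofs/P2-G36-SYM.md.  Std axioms.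
-/

namespace Summit.Ventures.PercRepro2

namespace RowC1

section PendZSym

variable {V : Type*} {E : Type*} [Fintype E] [DecidableEq E] [Fintype V] [DecidableEq V]
  {R : Type*} [Field R] [LinearOrder R] [IsStrictOrderedRing R]

/-- The symmetric quantity `(C3)`:
`p · Cov(O,B) + q · P(R_o) · P(R_b) − Cov(O,F) · P(R_b) − Cov(B,F) · P(R_o)` with
`F = connEvent a₂ v`, `O = connEvent a₂ o`, `B = connEvent a₂ b`, `R_o = Fᶜ ∩ connEvent v o`,
`R_b = Fᶜ ∩ connEvent v b`, `p = P(Fᶜ)`, `q = P(F)`. -/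
noncomputable def zsym (p : E → R) (ends : E → Sym2 V) (v a₂ o b : V) : R :=
  prob p (connEvent ends a₂ v)ᶜ *
      (prob p (connEvent ends a₂ o ∩ connEvent ends a₂ b) -
        prob p (connEvent ends a₂ o) * prob p (connEvent ends a₂ b)) +
    prob p (connEvent ends a₂ v) *
      (prob p ((connEvent ends a₂ v)ᶜ ∩ connEvent ends v o) *
        prob p ((connEvent ends a₂ v)ᶜ ∩ connEvent ends v b)) -
    (prob p (connEvent ends a₂ o ∩ connEvent ends a₂ v) -
        prob p (connEvent ends a₂ o) * prob p (connEvent ends a₂ v)) *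
      prob p ((connEvent ends a₂ v)ᶜ ∩ connEvent ends v b) -
    (prob p (connEvent ends a₂ b ∩ connEvent ends a₂ v) -
        prob p (connEvent ends a₂ b) * prob p (connEvent ends a₂ v)) *
      prob p ((connEvent ends a₂ v)ᶜ ∩ connEvent ends v o)

omit [Fintype V] [DecidableEq V] [LinearOrder R] [IsStrictOrderedRing R] in
/-- **`zpp = P(Fᶜ) · zsym + T₃ · (T₄ + P(Fᶜ) · P(R_b))`** — an identity of the probabilities
(only `P(Fᶜ) = 1 − P(F)` and `P(X) = P(X ∩ F) + P(X ∩ Fᶜ)` are used). -/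
theorem zpp_eq_zsym (p : E → R) (ends : E → Sym2 V) (v a₂ o b : V) :
    zpp p ends v a₂ o b =
      prob p (connEvent ends a₂ v)ᶜ * zsym p ends v a₂ o b +
        zppShiftO p ends v a₂ o *
          (zppShiftB p ends v a₂ b +
            prob p (connEvent ends a₂ v)ᶜ *
              prob p ((connEvent ends a₂ v)ᶜ ∩ connEvent ends v b)) := by
  have hO := prob_inter_add_prob_inter_compl p (connEvent ends a₂ o) (connEvent ends a₂ v)
  have hB := prob_inter_add_prob_inter_compl p (connEvent ends a₂ b) (connEvent ends a₂ v)
  have hF := prob_compl p (connEvent ends a₂ v)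
  unfold zpp zsym zppShiftO zppShiftB
  rw [hF] at *
  rw [← hO, ← hB]
  ring

omit [Fintype V] [DecidableEq V] in
/-- **`(C3) ⟹ (Z″)`**: if the symmetric quantity is nonnegative then so is the pendant-root
candidate — the correction `T₃ · (T₄ + P(Fᶜ) · P(R_b))` is a product of Harris shifts and
probabilities. -/
theorem zpp_nonneg_of_zsym_nonneg (p : E → R) (hp : IsProbVec p) (ends : E → Sym2 V)
    (v a₂ o b : V) (h : 0 ≤ zsym p ends v a₂ o b) : 0 ≤ zpp p ends v a₂ o b := by
  rw [zpp_eq_zsym]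
  have h3 := zppShiftO_nonneg p hp ends v a₂ o
  have h4 := zppShiftB_nonneg p hp ends v a₂ b
  have hpc : 0 ≤ prob p (connEvent ends a₂ v)ᶜ := prob_nonneg hp _
  have hRb : 0 ≤ prob p ((connEvent ends a₂ v)ᶜ ∩ connEvent ends v b) := prob_nonneg hp _
  have := mul_nonneg hpc h
  have := mul_nonneg h3 (add_nonneg h4 (mul_nonneg hpc hRb))
  linarith

omit [Fintype V] [DecidableEq V] [LinearOrder R] [IsStrictOrderedRing R] in
/-- `zsym` is symmetric in the two marks `o`, `b`. -/
theorem zsym_comm (p : E → R) (ends : E → Sym2 V) (v a₂ o b : V) :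
    zsym p ends v a₂ o b = zsym p ends v a₂ b o := by
  unfold zsym
  rw [Set.inter_comm (connEvent ends a₂ o) (connEvent ends a₂ b)]
  ring

end PendZSym

end RowC1

end Summit.Ventures.PercRepro2
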